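import Summits.QuantumFields.YangMills.Theorems.DressedRitz.Negative.LevelRotationLeakage
import Summits.QuantumFields.YangMills.Theorems.LuscherReductionRunningReductionExplicitNoIntruder
import HarnessLib

/-!
# Crux `DressedRitz` (stmt-QuantumFields-20205), line «polyakovlift» r8 → r9 — BLOCK-ROTATION ENGINE: Ritz values of an `l2`-symmetric map `T` agree across a pair
# all of whose rotations pass the defect bound; the block `P = K_β^[m]` qualifies and the registered BLOCK CLAUSE is such a defect bound

Standing crux disprover `ym-cdisprove-20205-1` g14 (refuter), supporting item stmt-QuantumFields-20205 (no verdict change; negative-side bookkeeping for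
the provers of the r9 stub `stub_blockLeakage : ∀ k, BlockLeakageForL (TransplantBasisLR k)` — LEAD g4's block-currency re-cut, pen `Lines-polyakovlift-r9.lean`;
the text itself is tree p586831).  Work file `Cruxes/DressedRitz/Disproof.lean` §18.  This file is the ENGINE half (abstract port of g11 `LevelRotationLeakage` §1–§3,
which was hard-wired to one step of `K_β`); the application to the registered text is `Negative/LevelRotationBlockLeakage.lean`.

* §1 ABSTRACT ENGINE.  For ANY map `T` of fine test functions that preserves physicality, is homogeneous, additive on physical vectors and `l2`-symmetric on
  physical vectors (hypotheses carried explicitly, no new definitions), the g11 chain re-run verbatim: defect `V_T(w) = ‖Tw‖²‖w‖² − ⟨w,Tw⟩² ≤ E‖w‖⁴` for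
  `w = u`, `w = v` and every rotation `w = c•u + s•v`, `c² + s² = 1` ⟹ `(⟨u,Tu⟩/‖u‖² − ⟨v,Tv⟩/‖v‖²)² ≤ 32E` (`symmOp_ritz_sub_sq_le_of_rotationDefect`):
  residual `‖Tw − r_w w‖² ≤ E‖w‖²` (null-safe), the quadratic rotation form `≤ 16E` for `U ± V`, the pure-real step `sq_sub_le_of_two_rotForms` (g11).
* §2 THE BLOCK `P = K_β^[m]` is such a `T` (`iterate_phys/_smul'/_add'/_symm`); the registered block clause `⟨w,K^{2m}w⟩⟨w,w⟩ ≤ (1+δ)⟨w,K^{m}w⟩²` IS the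
  defect bound `V_P(w) ≤ δ⟨w,Pw⟩² ≤ δ·λ₀^{2m}·‖w‖⁴` (`blockDefect_le_of_blockClause`; `0 ≤ ⟨w,Pw⟩ ≤ λ₀^m‖w‖²` by `transferMoment_le_pow_mul`); and a non-null
  block-dressed vector has a non-null raw vector (`l2_self_pos_of_iterate_pos`).

HONEST FRAMING: operator-theoretic bookkeeping on the CONDITIONAL femto rung R2b1; nothing here asserts or refutes a route item, and nothing bears on infinite
volume, the continuum limit or the Clay gap.  References: C. Davis, W. M. Kahan, SIAM J. Numer. Anal. 7 (1970) 1 [cite: DavisKahan1970, §2]; M. Lüscher, U. Wolff,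
NPB 339 (1990) 222 [cite: LuscherWolff1990]; M. Reed, B. Simon, Methods of Modern Mathematical Physics IV (1978) [cite: ReedSimonIV1978, Thm XIII.1].
-/

set_option autoImplicit false

noncomputable section

open MeasureTheory Filter Topology Real
open Literature.MathematicalPhysics.QuantumFieldTheory Literature.MathematicalPhysics.QuantumLattice Literature.Analysis.OperatorTheory.YMMatrixModel
open scoped BigOperators

namespace Summit.QuantumFields.YangMills.Theorems.FemtoTransferGap.PolyakovLift.Negative

open Summit.QuantumFields.YangMills.Theorems.FemtoTransferGap Summit.QuantumFields.YangMills.Theorems.FemtoTransferGap.PolyakovLift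

/-! ## §1 Abstract engine: a physicality-preserving, homogeneous, additive, `l2`-symmetric map `T`

Hypotheses carried explicitly (no new definitions): `hTphys : ∀ w, IsPhys w → IsPhys (T w)`, `hTsmul : ∀ t w, T (t • w) = t • T w`,
`hTadd : ∀ u v, IsPhys u → IsPhys v → T (u + v) = T u + T v`, `hTsymm : ∀ u v, IsPhys u → IsPhys v → l2 (T u) v = l2 u (T v)`.
Notation of the docstrings: `V_T(w) = ‖Tw‖²‖w‖² − ⟨w,Tw⟩²`, `r_w = ⟨w,Tw⟩/‖w‖²`, `res w = Tw − r_w w`. -/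

section AbstractOp

variable {L : ℕ} [NeZero L] {T : (GaugeConfig 3 L SU2 → ℝ) → (GaugeConfig 3 L SU2 → ℝ)}

/-- `T` of a null physical vector is null (symmetry + Cauchy–Schwarz). [folklore] -/
theorem symmOp_self_eq_zero_of_null (hTphys : ∀ w, IsPhys w → IsPhys (T w))
    (hTsymm : ∀ u v, IsPhys u → IsPhys v → l2 (T u) v = l2 u (T v))
    {w : GaugeConfig 3 L SU2 → ℝ} (hw : IsPhys w) (h0 : l2 w w = 0) : l2 (T w) (T w) = 0 := by
  rw [hTsymm w (T w) hw (hTphys w hw)]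
  have h := sq_l2_le hw (hTphys _ (hTphys w hw))
  rw [h0, zero_mul] at h
  exact pow_eq_zero_iff two_ne_zero |>.1 (le_antisymm h (sq_nonneg _))

/-- Homogeneity of the defect: `V_T(t•w) = t⁴ V_T(w)`. [folklore] -/
theorem symmOp_defect_smul (hTsmul : ∀ (t : ℝ) (w : GaugeConfig 3 L SU2 → ℝ), T (t • w) = t • T w) (t : ℝ) (w : GaugeConfig 3 L SU2 → ℝ) :
    l2 (T (t • w)) (T (t • w)) * l2 (t • w) (t • w) - l2 (t • w) (T (t • w)) ^ 2 =
      t ^ 4 * (l2 (T w) (T w) * l2 w w - l2 w (T w) ^ 2) := by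
  rw [hTsmul, l2_smul_left, l2_smul_right'', l2_smul_left, l2_smul_right'', l2_smul_left, l2_smul_right'']
  ring

/-- Homogeneity of the defect bound: `V_T(w) ≤ E‖w‖⁴ ⟹ V_T(t•w) ≤ E‖t•w‖⁴`. [folklore] -/
theorem symmOp_bound_smul (hTsmul : ∀ (t : ℝ) (w : GaugeConfig 3 L SU2 → ℝ), T (t • w) = t • T w) {E : ℝ} {w : GaugeConfig 3 L SU2 → ℝ}
    (h : l2 (T w) (T w) * l2 w w - l2 w (T w) ^ 2 ≤ E * l2 w w ^ 2) (t : ℝ) :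
    l2 (T (t • w)) (T (t • w)) * l2 (t • w) (t • w) - l2 (t • w) (T (t • w)) ^ 2 ≤ E * l2 (t • w) (t • w) ^ 2 := by
  rw [symmOp_defect_smul hTsmul, l2_smul_left, l2_smul_right'']
  calc t ^ 4 * (l2 (T w) (T w) * l2 w w - l2 w (T w) ^ 2)
        = (t ^ 2) ^ 2 * (l2 (T w) (T w) * l2 w w - l2 w (T w) ^ 2) := by ring
    _ ≤ (t ^ 2) ^ 2 * (E * l2 w w ^ 2) := mul_le_mul_of_nonneg_left h (sq_nonneg _)
    _ = E * (t * (t * l2 w w)) ^ 2 := by ring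

/-- Norm of the residual at the Ritz value: `‖Tw − r_w w‖² = ‖Tw‖² − ⟨w,Tw⟩²/‖w‖²` (`‖w‖² > 0`). [folklore] -/
theorem symmOp_residual_self (hTphys : ∀ w, IsPhys w → IsPhys (T w))
    (hTsymm : ∀ u v, IsPhys u → IsPhys v → l2 (T u) v = l2 u (T v))
    {w : GaugeConfig 3 L SU2 → ℝ} (hw : IsPhys w) (hn : 0 < l2 w w) :
    l2 (T w + (-(l2 w (T w) / l2 w w)) • w) (T w + (-(l2 w (T w) / l2 w w)) • w) =
      l2 (T w) (T w) - l2 w (T w) ^ 2 / l2 w w := by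
  have hTw : IsPhys (T w) := hTphys w hw
  have e1 : T w + (-(l2 w (T w) / l2 w w)) • w = (1 : ℝ) • T w + (-(l2 w (T w) / l2 w w)) • w := by rw [one_smul]
  rw [e1, l2_self_add_smul hTw hw, hTsymm w w hw hw]
  have hn0 : l2 w w ≠ 0 := hn.ne'
  field_simp
  ring

/-- ★ From the defect to the residual, null-safe: `V_T(w) ≤ E‖w‖⁴ ⟹ ‖res w‖² ≤ E‖w‖²`. [folklore] -/
theorem symmOp_residual_self_le (hTphys : ∀ w, IsPhys w → IsPhys (T w))
    (hTsymm : ∀ u v, IsPhys u → IsPhys v → l2 (T u) v = l2 u (T v))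
    {E : ℝ} {w : GaugeConfig 3 L SU2 → ℝ} (hw : IsPhys w)
    (h : l2 (T w) (T w) * l2 w w - l2 w (T w) ^ 2 ≤ E * l2 w w ^ 2) :
    l2 (T w + (-(l2 w (T w) / l2 w w)) • w) (T w + (-(l2 w (T w) / l2 w w)) • w) ≤ E * l2 w w := by
  rcases (l2_self_nonneg w).eq_or_lt with h0 | hpos
  · have h0' : l2 w w = 0 := h0.symm
    have hres : T w + (-(l2 w (T w) / l2 w w)) • w = T w := by
      rw [h0', div_zero, neg_zero, zero_smul, add_zero]
    rw [hres, symmOp_self_eq_zero_of_null hTphys hTsymm hw h0', h0', mul_zero]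
  · rw [symmOp_residual_self hTphys hTsymm hw hpos]
    have e : l2 (T w) (T w) - l2 w (T w) ^ 2 / l2 w w = (l2 (T w) (T w) * l2 w w - l2 w (T w) ^ 2) / l2 w w := by
      field_simp
    rw [e, div_le_iff₀ hpos]
    calc _ ≤ E * l2 w w ^ 2 := h
      _ = E * l2 w w * l2 w w := by ring

/-- The residual PACKAGED: a physical `ρ = res w` with `‖ρ‖² ≤ E‖w‖²`. [folklore] -/
theorem symmOp_exists_residual (hTphys : ∀ w, IsPhys w → IsPhys (T w))
    (hTsymm : ∀ u v, IsPhys u → IsPhys v → l2 (T u) v = l2 u (T v))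
    {E : ℝ} {w : GaugeConfig 3 L SU2 → ℝ} (hw : IsPhys w)
    (h : l2 (T w) (T w) * l2 w w - l2 w (T w) ^ 2 ≤ E * l2 w w ^ 2) :
    ∃ ρ : GaugeConfig 3 L SU2 → ℝ, IsPhys ρ ∧ l2 ρ ρ ≤ E * l2 w w ∧ T w + (-(l2 w (T w) / l2 w w)) • w = ρ :=
  ⟨_, (hTphys w hw).add (hw.smul _), symmOp_residual_self_le hTphys hTsymm hw h, rfl⟩

/-- For UNIT physical `U, V` passing the defect bound with tolerance `E` together with `U + V` (Ritz value `μ`):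
`(r_U − μ)² + 2(r_U − μ)(r_V − μ)⟨U,V⟩ + (r_V − μ)² ≤ 16E`. [folklore] -/
theorem symmOp_rot_form_le (hTphys : ∀ w, IsPhys w → IsPhys (T w))
    (hTadd : ∀ u v, IsPhys u → IsPhys v → T (u + v) = T u + T v)
    (hTsymm : ∀ u v, IsPhys u → IsPhys v → l2 (T u) v = l2 u (T v))
    {U V : GaugeConfig 3 L SU2 → ℝ} {E : ℝ} (hU : IsPhys U) (hV : IsPhys V) (h1U : l2 U U = 1) (h1V : l2 V V = 1)
    (hLU : l2 (T U) (T U) * l2 U U - l2 U (T U) ^ 2 ≤ E * l2 U U ^ 2)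
    (hLV : l2 (T V) (T V) * l2 V V - l2 V (T V) ^ 2 ≤ E * l2 V V ^ 2)
    (hLW : l2 (T (U + V)) (T (U + V)) * l2 (U + V) (U + V) - l2 (U + V) (T (U + V)) ^ 2 ≤ E * l2 (U + V) (U + V) ^ 2)
    (μ : ℝ) (hμ : l2 (U + V) (T (U + V)) / l2 (U + V) (U + V) = μ) :
    (l2 U (T U) - μ) ^ 2 + 2 * ((l2 U (T U) - μ) * (l2 V (T V) - μ)) * l2 U V + (l2 V (T V) - μ) ^ 2 ≤ 16 * E := by
  obtain ⟨ρU, hρU, hnU, eU⟩ := symmOp_exists_residual hTphys hTsymm hU hLU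
  obtain ⟨ρV, hρV, hnV, eV⟩ := symmOp_exists_residual hTphys hTsymm hV hLV
  obtain ⟨ρW, hρW, hnW, eW⟩ := symmOp_exists_residual hTphys hTsymm (hU.add hV) hLW
  rw [h1U, mul_one] at hnU
  rw [h1V, mul_one] at hnV
  have hKUVx : ∀ x, T (U + V) x = T U x + T V x := fun x => by
    simp only [hTadd U V hU hV, Pi.add_apply]
  have hX : (l2 U (T U) - μ) • U + (l2 V (T V) - μ) • V = ((-1 : ℝ) • ρU + (-1 : ℝ) • ρV) + ρW := by
    rw [← eU, ← eV, ← eW, h1U, h1V, div_one, div_one, hμ]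
    funext x
    simp only [Pi.add_apply, Pi.smul_apply, smul_eq_mul, hKUVx]
    ring
  have hUV : l2 (U + V) (U + V) ≤ 4 := by
    have h := l2_add_self_le_two hU hV; rw [h1U, h1V] at h; linarith
  have hE : 0 ≤ E := (l2_self_nonneg _).trans hnU
  have hlhs : l2 ((l2 U (T U) - μ) • U + (l2 V (T V) - μ) • V) ((l2 U (T U) - μ) • U + (l2 V (T V) - μ) • V) =
      (l2 U (T U) - μ) ^ 2 + 2 * ((l2 U (T U) - μ) * (l2 V (T V) - μ)) * l2 U V + (l2 V (T V) - μ) ^ 2 := by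
    rw [l2_self_add_smul hU hV, h1U, h1V]; ring
  rw [← hlhs, hX]
  calc l2 ((-1 : ℝ) • ρU + (-1 : ℝ) • ρV + ρW) ((-1 : ℝ) • ρU + (-1 : ℝ) • ρV + ρW)
        ≤ 2 * (l2 ((-1 : ℝ) • ρU + (-1 : ℝ) • ρV) ((-1 : ℝ) • ρU + (-1 : ℝ) • ρV) + l2 ρW ρW) :=
          l2_add_self_le_two ((hρU.smul _).add (hρV.smul _)) hρW
    _ ≤ 2 * (2 * (l2 ((-1 : ℝ) • ρU) ((-1 : ℝ) • ρU) + l2 ((-1 : ℝ) • ρV) ((-1 : ℝ) • ρV)) + l2 ρW ρW) := by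
          gcongr; exact l2_add_self_le_two (hρU.smul _) (hρV.smul _)
    _ = 2 * (2 * (l2 ρU ρU + l2 ρV ρV) + l2 ρW ρW) := by rw [l2_neg_one_smul_self, l2_neg_one_smul_self]
    _ ≤ 2 * (2 * (E + E) + E * 4) := by gcongr; exact hnW.trans (mul_le_mul_of_nonneg_left hUV hE)
    _ = 16 * E := by ring

/-- ★ UNIT form: unit physical `U, V` passing the defect bound with tolerance `E` together with `U + V` and `U − V` ⟹ `(r_U − r_V)² ≤ 32E`. [folklore] -/
theorem symmOp_ritz_sub_sq_le_unit (hTphys : ∀ w, IsPhys w → IsPhys (T w))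
    (hTsmul : ∀ (t : ℝ) (w : GaugeConfig 3 L SU2 → ℝ), T (t • w) = t • T w)
    (hTadd : ∀ u v, IsPhys u → IsPhys v → T (u + v) = T u + T v)
    (hTsymm : ∀ u v, IsPhys u → IsPhys v → l2 (T u) v = l2 u (T v))
    {U V : GaugeConfig 3 L SU2 → ℝ} {E : ℝ} (hU : IsPhys U) (hV : IsPhys V) (h1U : l2 U U = 1) (h1V : l2 V V = 1)
    (hLU : l2 (T U) (T U) * l2 U U - l2 U (T U) ^ 2 ≤ E * l2 U U ^ 2)
    (hLV : l2 (T V) (T V) * l2 V V - l2 V (T V) ^ 2 ≤ E * l2 V V ^ 2)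
    (hLW : l2 (T (U + V)) (T (U + V)) * l2 (U + V) (U + V) - l2 (U + V) (T (U + V)) ^ 2 ≤ E * l2 (U + V) (U + V) ^ 2)
    (hLW' : l2 (T (U + (-1 : ℝ) • V)) (T (U + (-1 : ℝ) • V)) * l2 (U + (-1 : ℝ) • V) (U + (-1 : ℝ) • V) -
        l2 (U + (-1 : ℝ) • V) (T (U + (-1 : ℝ) • V)) ^ 2 ≤ E * l2 (U + (-1 : ℝ) • V) (U + (-1 : ℝ) • V) ^ 2) :
    (l2 U (T U) - l2 V (T V)) ^ 2 ≤ 32 * E := by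
  have hE : 0 ≤ E := by
    have h := sq_l2_le hU (hTphys U hU)
    have h' := hLU
    simp only [h1U, one_mul, mul_one, one_pow] at h h'
    linarith
  have hV' : IsPhys ((-1 : ℝ) • V) := hV.smul _
  have h1V' : l2 ((-1 : ℝ) • V) ((-1 : ℝ) • V) = 1 := by rw [l2_neg_one_smul_self, h1V]
  have hLV' := symmOp_bound_smul hTsmul hLV (-1)
  obtain ⟨μ, hμ⟩ : ∃ μ : ℝ, l2 (U + V) (T (U + V)) / l2 (U + V) (U + V) = μ := ⟨_, rfl⟩
  obtain ⟨μ', hμ'⟩ : ∃ μ' : ℝ, l2 (U + (-1 : ℝ) • V) (T (U + (-1 : ℝ) • V)) / l2 (U + (-1 : ℝ) • V) (U + (-1 : ℝ) • V) = μ' :=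
    ⟨_, rfl⟩
  have hF1 := symmOp_rot_form_le hTphys hTadd hTsymm hU hV h1U h1V hLU hLV hLW μ hμ
  have hF2 := symmOp_rot_form_le hTphys hTadd hTsymm hU hV' h1U h1V' hLU hLV' hLW' μ' hμ'
  have hrV' : l2 ((-1 : ℝ) • V) (T ((-1 : ℝ) • V)) = l2 V (T V) := by
    rw [hTsmul, l2_smul_left, l2_smul_right'']; ring
  have hpV' : l2 U ((-1 : ℝ) • V) = -l2 U V := by rw [l2_smul_right'']; ring
  rw [hrV', hpV'] at hF2
  have hp : l2 U V ^ 2 ≤ 1 := by have h := sq_l2_le hU hV; rwa [h1U, h1V, mul_one] at h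
  obtain ⟨hp2, hp1⟩ := abs_le.1 ((sq_le_one_iff_abs_le_one _).1 hp)
  have key := sq_sub_le_of_two_rotForms hp1 hp2 (by linarith) hF1 hF2 (by ring)
  have e : l2 U (T U) - l2 V (T V) = (l2 U (T U) - μ) - (l2 V (T V) - μ) := by ring
  rw [e]
  linarith

/-- ★ **Ritz values of `T` agree when every rotation of the pair passes the defect bound.**  Physical `u, v` with `‖u‖², ‖v‖² > 0`; if
`V_T(w) ≤ E‖w‖⁴` for `w = u`, `w = v` and every `w = c•u + s•v` with `c² + s² = 1`, then `(⟨u,Tu⟩/‖u‖² − ⟨v,Tv⟩/‖v‖²)² ≤ 32·E` — whatever the angle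
between `u` and `v`. [cite: DavisKahan1970, §2] [cite: LuscherWolff1990] -/
theorem symmOp_ritz_sub_sq_le_of_rotationDefect (hTphys : ∀ w, IsPhys w → IsPhys (T w))
    (hTsmul : ∀ (t : ℝ) (w : GaugeConfig 3 L SU2 → ℝ), T (t • w) = t • T w)
    (hTadd : ∀ u v, IsPhys u → IsPhys v → T (u + v) = T u + T v)
    (hTsymm : ∀ u v, IsPhys u → IsPhys v → l2 (T u) v = l2 u (T v))
    {u v : GaugeConfig 3 L SU2 → ℝ} (hu : IsPhys u) (hv : IsPhys v) (hnu : 0 < l2 u u) (hnv : 0 < l2 v v) {E : ℝ}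
    (hleak_u : l2 (T u) (T u) * l2 u u - l2 u (T u) ^ 2 ≤ E * l2 u u ^ 2)
    (hleak_v : l2 (T v) (T v) * l2 v v - l2 v (T v) ^ 2 ≤ E * l2 v v ^ 2)
    (hleak_rot : ∀ c s : ℝ, c ^ 2 + s ^ 2 = 1 →
      l2 (T (c • u + s • v)) (T (c • u + s • v)) * l2 (c • u + s • v) (c • u + s • v) -
          l2 (c • u + s • v) (T (c • u + s • v)) ^ 2 ≤ E * l2 (c • u + s • v) (c • u + s • v) ^ 2) :
    (l2 u (T u) / l2 u u - l2 v (T v) / l2 v v) ^ 2 ≤ 32 * E := by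
  obtain ⟨a, ha0, ha2⟩ : ∃ a : ℝ, 0 < a ∧ a ^ 2 * l2 u u = 1 :=
    ⟨(Real.sqrt (l2 u u))⁻¹, inv_pos.2 (Real.sqrt_pos.2 hnu), by rw [inv_pow, Real.sq_sqrt hnu.le, inv_mul_cancel₀ hnu.ne']⟩
  obtain ⟨b, hb0, hb2⟩ : ∃ b : ℝ, 0 < b ∧ b ^ 2 * l2 v v = 1 :=
    ⟨(Real.sqrt (l2 v v))⁻¹, inv_pos.2 (Real.sqrt_pos.2 hnv), by rw [inv_pow, Real.sq_sqrt hnv.le, inv_mul_cancel₀ hnv.ne']⟩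
  obtain ⟨t, ht0, ht2⟩ : ∃ t : ℝ, 0 < t ∧ t ^ 2 = a ^ 2 + b ^ 2 :=
    ⟨Real.sqrt (a ^ 2 + b ^ 2), Real.sqrt_pos.2 (by positivity), Real.sq_sqrt (by positivity)⟩
  have hU : IsPhys (a • u) := hu.smul a
  have hV : IsPhys (b • v) := hv.smul b
  have h1U : l2 (a • u) (a • u) = 1 := by rw [l2_smul_left, l2_smul_right'', ← ha2]; ring
  have h1V : l2 (b • v) (b • v) = 1 := by rw [l2_smul_left, l2_smul_right'', ← hb2]; ring
  have hcs : (a / t) ^ 2 + (b / t) ^ 2 = 1 := by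
    rw [show (a / t) ^ 2 + (b / t) ^ 2 = (a ^ 2 + b ^ 2) / t ^ 2 by ring, ← ht2, div_self (pow_ne_zero 2 ht0.ne')]
  have hcs' : (a / t) ^ 2 + (-b / t) ^ 2 = 1 := by rw [neg_div, neg_sq]; exact hcs
  have eW : t • ((a / t) • u + (b / t) • v) = a • u + b • v := by
    rw [smul_add, smul_smul, smul_smul, mul_div_cancel₀ _ ht0.ne', mul_div_cancel₀ _ ht0.ne']
  have eW' : t • ((a / t) • u + (-b / t) • v) = a • u + (-1 : ℝ) • (b • v) := by
    rw [smul_add, smul_smul, smul_smul, smul_smul, mul_div_cancel₀ _ ht0.ne', mul_div_cancel₀ _ ht0.ne', neg_one_mul]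
  have hLW := symmOp_bound_smul hTsmul (hleak_rot _ _ hcs) t
  have hLW' := symmOp_bound_smul hTsmul (hleak_rot _ _ hcs') t
  rw [eW] at hLW
  rw [eW'] at hLW'
  have key := symmOp_ritz_sub_sq_le_unit hTphys hTsmul hTadd hTsymm hU hV h1U h1V (symmOp_bound_smul hTsmul hleak_u a)
    (symmOp_bound_smul hTsmul hleak_v b) hLW hLW'
  have hrU : l2 u (T u) / l2 u u = l2 (a • u) (T (a • u)) := by
    rw [hTsmul, l2_smul_left, l2_smul_right'', div_eq_iff hnu.ne']
    calc l2 u (T u) = (a ^ 2 * l2 u u) * l2 u (T u) := by rw [ha2, one_mul]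
      _ = a * (a * l2 u (T u)) * l2 u u := by ring
  have hrV : l2 v (T v) / l2 v v = l2 (b • v) (T (b • v)) := by
    rw [hTsmul, l2_smul_left, l2_smul_right'', div_eq_iff hnv.ne']
    calc l2 v (T v) = (b ^ 2 * l2 v v) * l2 v (T v) := by rw [hb2, one_mul]
      _ = b * (b * l2 v (T v)) * l2 v v := by ring
  rw [hrU, hrV]
  exact key

end AbstractOp

/-! ## §2 The block `P = K_β^[m]` qualifies; the block clause IS the defect bound -/

section Block

variable {L : ℕ} [NeZero L] (β : ℝ)

/-- `K_β^[m]` preserves physicality. [folklore] -/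
theorem iterate_phys (m : ℕ) : ∀ w : GaugeConfig 3 L SU2 → ℝ, IsPhys w → IsPhys ((transferApply β)^[m] w) :=
  fun _ hw => isPhys_iterate_transferApply β hw m

/-- `K_β^[m]` is homogeneous. [folklore] -/
theorem iterate_smul' (m : ℕ) : ∀ (t : ℝ) (w : GaugeConfig 3 L SU2 → ℝ), (transferApply β)^[m] (t • w) = t • (transferApply β)^[m] w :=
  fun t w => iterate_transferApply_smul β t w m

/-- `K_β^[m]` is additive on physical vectors. [folklore] -/
theorem iterate_add' (m : ℕ) : ∀ u v : GaugeConfig 3 L SU2 → ℝ, IsPhys u → IsPhys v →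
    (transferApply β)^[m] (u + v) = (transferApply β)^[m] u + (transferApply β)^[m] v :=
  fun _ _ hu hv => iterate_transferApply_add β hu hv m

/-- `K_β^[m]` is `l2`-symmetric on physical vectors. [cite: ReedSimonIV1978, Thm XIII.1] -/
theorem iterate_symm (m : ℕ) : ∀ u v : GaugeConfig 3 L SU2 → ℝ, IsPhys u → IsPhys v →
    l2 ((transferApply β)^[m] u) v = l2 u ((transferApply β)^[m] v) := by
  intro u v hu hv
  have h := l2_iterate_left_right β hu hv m 0
  simp only [Function.iterate_zero, id_eq, zero_add] at h
  exact h.symm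

/-- ★ **The registered block clause IS a defect bound for `P = K_β^[m]`**: for physical `w` and `β ≥ 0`,
`⟨w,K^{2m}w⟩⟨w,w⟩ ≤ (1+δ)⟨w,K^{m}w⟩²` (`δ ≥ 0`) ⟹ `‖Pw‖²‖w‖² − ⟨w,Pw⟩² ≤ δ·λ₀^{2m}·‖w‖⁴` (`‖Pw‖² = ⟨w,K^{2m}w⟩`; `0 ≤ ⟨w,Pw⟩ ≤ λ₀^m‖w‖²`).
[cite: ReedSimonIV1978, Thm XIII.1] -/
theorem blockDefect_le_of_blockClause {β : ℝ} (hβ : 0 ≤ β) {w : GaugeConfig 3 L SU2 → ℝ} (hw : IsPhys w) (m : ℕ) {δ : ℝ} (hδ : 0 ≤ δ)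
    (h : l2 w ((transferApply β)^[2 * m] w) * l2 w w ≤ (1 + δ) * l2 w ((transferApply β)^[m] w) ^ 2) :
    l2 ((transferApply β)^[m] w) ((transferApply β)^[m] w) * l2 w w - l2 w ((transferApply β)^[m] w) ^ 2 ≤
      δ * levelValue su2Rep L β 0 ^ (2 * m) * l2 w w ^ 2 := by
  have hPP : l2 ((transferApply β)^[m] w) ((transferApply β)^[m] w) = l2 w ((transferApply β)^[2 * m] w) := by
    rw [l2_iterate_iterate β hw m m, two_mul]
  have hray : l2 w ((transferApply β)^[m] w) ≤ levelValue su2Rep L β 0 ^ m * l2 w w := by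
    have h1 := transferMoment_le_pow_mul hβ hw m
    rwa [transferMoment, transferMoment_zero] at h1
  have hnn : 0 ≤ l2 w ((transferApply β)^[m] w) := by
    have h1 := transferMoment_nonneg hβ hw m
    rwa [transferMoment] at h1
  have hsq : l2 w ((transferApply β)^[m] w) ^ 2 ≤ (levelValue su2Rep L β 0 ^ m * l2 w w) ^ 2 := pow_le_pow_left₀ hnn hray 2
  rw [hPP]
  calc l2 w ((transferApply β)^[2 * m] w) * l2 w w - l2 w ((transferApply β)^[m] w) ^ 2
        ≤ δ * l2 w ((transferApply β)^[m] w) ^ 2 := by linarith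
    _ ≤ δ * (levelValue su2Rep L β 0 ^ m * l2 w w) ^ 2 := mul_le_mul_of_nonneg_left hsq hδ
    _ = δ * levelValue su2Rep L β 0 ^ (2 * m) * l2 w w ^ 2 := by rw [pow_mul, mul_pow, ← pow_mul, mul_comm m 2]; ring

/-- A non-null block-dressed vector has a non-null raw vector: `‖K^[m]v‖² ≤ λ₀^{2m}‖v‖²`. [folklore] -/
theorem l2_self_pos_of_iterate_pos {β : ℝ} (hβ : 0 ≤ β) {v : GaugeConfig 3 L SU2 → ℝ} (hv : IsPhys v) (m : ℕ)
    (h : 0 < l2 ((transferApply β)^[m] v) ((transferApply β)^[m] v)) : 0 < l2 v v := by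
  have hle : l2 ((transferApply β)^[m] v) ((transferApply β)^[m] v) ≤ levelValue su2Rep L β 0 ^ (2 * m) * l2 v v := by
    have h1 := transferMoment_le_pow_mul hβ hv (2 * m)
    rwa [transferMoment_two_mul β hv, transferMoment_zero] at h1
  rcases (l2_self_nonneg v).eq_or_lt with h0 | hpos
  · rw [← h0, mul_zero] at hle; exact absurd hle (not_le.2 h)
  · exact hpos

end Block

end Summit.QuantumFields.YangMills.Theorems.FemtoTransferGap.PolyakovLift.Negative

end
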